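import Mathlib
import Summits.CriticalPhenomena.PercolationContinuityZ3.Theorems.PercNearOneGluingNoHeavyLowerTailThreeFamilyRankSocket

/-!
# TRIPLE-0: three families have no common plain vector — the cyclic Hall count, unconditionally

Helper file for crux `stmt-CriticalPhenomena-4575` (`NoHeavyLowerTail`, route `PercNearOneGluingNoHeavy`),
new-inequality factory seat `prim-ineq-gen-3` (gen 9).  Everything here is PROVED.

**Theorem TRIPLE-0 (hypothesis-free).**  Let `P, Q, R` be arbitrary finite families of subsets of a finite set `S`
and `κ_P, κ_Q, κ_R` functions supported on them.  If the moment functions `E ↦ Σ_{U ⊇ E} κ_T(U)` of the three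
families agree on every `E ∈ G(S; P, Q, R)` (subsets of within-family differences, cross meets and double
differences), then `κ_P = κ_Q = κ_R`.  Proof: induction on `S`; pushing forward along `U ↦ U \ {w}` preserves the
hypothesis (every generator of the pushed families lies inside a generator), so by induction
`κ_T(V) + κ_T(V ∪ {w})` is independent of `T` for every `w` and `V ∌ w`; hence `κ_P − κ_Q = a (−1)^{#U}` for a constant
`a`, and `a ≠ 0` would force every subset of `S` into `P ∪ Q`, in particular `S` and `∅` — and then `S` itself is a
generator (`S \ ∅`, `S ∩ S`, or `S \ (∅ ∪ ∅)`), where the hypothesis reads `±a = 0`.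

Consequences (with `ThreeFamilyRank.card_add_card_add_card_le`, Theorem A′): `MS3-down`
`#P + #Q + #R ≤ #G(S;P,Q,R)` for pairwise intersecting families with no common member
(`ThreeFamilyRank.card_le_card_downFamily`), the hypothesis `hTriple` of
`card_le_card_goods_above_cyclic_of_triple`, and therefore the capacity-one Hall count for cyclic selections
`OrientedAntipodalHall.card_le_card_goods_above_cyclic'` with NO combinatorial hypothesis left
(memo `run/shared/lean/prim/prim-ineq-gen-3/PROOF-TRIPLE0.md`; prim-ineq-gen-3 gen 9, 2026-08-20).
-/

namespace Summit.CriticalPhenomena.PercolationContinuityZ3.Theorems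

namespace ThreeFamilyRank

open Finset Module
open scoped FinsetFamily

variable {α : Type*} [DecidableEq α]

/-- Moment function of `κ` over the ground set `S`: `E ↦ Σ_{U ⊆ S, E ⊆ U} κ U`. -/
def mom (S : Finset α) (κ : Finset α → ℚ) (E : Finset α) : ℚ :=
  ∑ U ∈ S.powerset, if E ⊆ U then κ U else 0

/-- Push-forward of `κ` along `U ↦ U.erase w`. -/
def push (w : α) (κ : Finset α → ℚ) (T : Finset α) : ℚ :=
  if w ∈ T then 0 else κ T + κ (insert w T)

/-- The push-forward preserves moments of `w`-free sets. -/
theorem mom_push (S : Finset α) {w : α} (hw : w ∉ S) (κ : Finset α → ℚ) {E : Finset α} (hE : w ∉ E) :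
    mom S (push w κ) E = mom (insert w S) κ E := by
  rw [mom, mom, Finset.sum_powerset_insert hw]
  rw [← Finset.sum_add_distrib]
  refine Finset.sum_congr rfl fun T hT => ?_
  have hwT : w ∉ T := fun h => hw (Finset.mem_powerset.mp hT h)
  have hsub : (E ⊆ insert w T) ↔ E ⊆ T := Finset.subset_insert_iff_of_notMem hE
  simp only [push, hwT, if_false, hsub]
  split_ifs <;> simp

/-- The push-forward of a function supported on `P` (members inside `insert w S`) is supported on the pushed
family `P.image (·.erase w)`. -/
theorem push_eq_zero_of_not_mem {w : α} {P : Finset (Finset α)} {κ : Finset α → ℚ}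
    (hκ : ∀ U, U ∉ P → κ U = 0) {T : Finset α} (hT : T ∉ P.image fun U => U.erase w) :
    push w κ T = 0 := by
  unfold push
  split_ifs with hwT
  · rfl
  · have h1 : κ T = 0 := by
      apply hκ; intro hTP
      exact hT (Finset.mem_image.mpr ⟨T, hTP, Finset.erase_eq_of_notMem hwT⟩)
    have h2 : κ (insert w T) = 0 := by
      apply hκ; intro hTP
      exact hT (Finset.mem_image.mpr ⟨insert w T, hTP, Finset.erase_insert hwT⟩)
    rw [h1, h2, add_zero]

/-- Every generator of the pushed families lies inside a generator of the original families. -/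
theorem exists_mem_gens_of_mem_gens_image (w : α) (P Q R : Finset (Finset α)) {T' : Finset α}
    (hT' : T' ∈ gens (P.image fun U => U.erase w) (Q.image fun U => U.erase w) (R.image fun U => U.erase w)) :
    ∃ T ∈ gens P Q R, T' ⊆ T := by
  -- unpack the nine components
  have key_diff : ∀ A B : Finset α, A.erase w \ B.erase w ⊆ A \ B := by
    intro A B x hx
    simp only [Finset.mem_sdiff, Finset.mem_erase] at hx ⊢
    exact ⟨hx.1.2, fun hB => hx.2 ⟨hx.1.1, hB⟩⟩
  have key_inf : ∀ A B : Finset α, A.erase w ∩ B.erase w ⊆ A ∩ B := by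
    intro A B x hx
    simp only [Finset.mem_inter, Finset.mem_erase] at hx ⊢
    exact ⟨hx.1.2, hx.2.2⟩
  have key_dd : ∀ A B C : Finset α, A.erase w \ (B.erase w ∪ C.erase w) ⊆ A \ (B ∪ C) := by
    intro A B C x hx
    simp only [Finset.mem_sdiff, Finset.mem_erase, Finset.mem_union, not_or] at hx ⊢
    exact ⟨hx.1.2, fun hB => hx.2.1 ⟨hx.1.1, hB⟩, fun hC => hx.2.2 ⟨hx.1.1, hC⟩⟩
  -- helper: differences of an image family
  have hdiffs : ∀ A : Finset (Finset α), ∀ T' ∈ (A.image fun U => U.erase w) \\ (A.image fun U => U.erase w),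
      ∃ T ∈ A \\ A, T' ⊆ T := by
    intro A T' h
    obtain ⟨a, ha, b, hb, rfl⟩ := Finset.mem_diffs.mp h
    obtain ⟨a0, ha0, rfl⟩ := Finset.mem_image.mp ha
    obtain ⟨b0, hb0, rfl⟩ := Finset.mem_image.mp hb
    exact ⟨a0 \ b0, Finset.mem_diffs.mpr ⟨a0, ha0, b0, hb0, rfl⟩, key_diff a0 b0⟩
  have hinfs : ∀ A B : Finset (Finset α), ∀ T' ∈ (A.image fun U => U.erase w) ⊼ (B.image fun U => U.erase w),
      ∃ T ∈ A ⊼ B, T' ⊆ T := by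
    intro A B T' h
    obtain ⟨a, ha, b, hb, rfl⟩ := Finset.mem_infs.mp h
    obtain ⟨a0, ha0, rfl⟩ := Finset.mem_image.mp ha
    obtain ⟨b0, hb0, rfl⟩ := Finset.mem_image.mp hb
    exact ⟨a0 ∩ b0, Finset.mem_infs.mpr ⟨a0, ha0, b0, hb0, rfl⟩, key_inf a0 b0⟩
  have hdd : ∀ A B C : Finset (Finset α), ∀ T' ∈
      (((A.image fun U => U.erase w) ×ˢ ((B.image fun U => U.erase w) ×ˢ (C.image fun U => U.erase w))).image
        fun p : Finset α × (Finset α × Finset α) => p.1 \ (p.2.1 ∪ p.2.2)),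
      ∃ T ∈ ((A ×ˢ (B ×ˢ C)).image fun p : Finset α × (Finset α × Finset α) => p.1 \ (p.2.1 ∪ p.2.2)),
        T' ⊆ T := by
    intro A B C T' h
    obtain ⟨p, hp, rfl⟩ := Finset.mem_image.mp h
    obtain ⟨hp1, hp2⟩ := Finset.mem_product.mp hp
    obtain ⟨hp21, hp22⟩ := Finset.mem_product.mp hp2
    obtain ⟨a0, ha0, ha0e⟩ := Finset.mem_image.mp hp1
    obtain ⟨b0, hb0, hb0e⟩ := Finset.mem_image.mp hp21
    obtain ⟨c0, hc0, hc0e⟩ := Finset.mem_image.mp hp22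
    refine ⟨a0 \ (b0 ∪ c0), Finset.mem_image.mpr ⟨(a0, (b0, c0)), ?_, rfl⟩, ?_⟩
    · exact Finset.mem_product.mpr ⟨ha0, Finset.mem_product.mpr ⟨hb0, hc0⟩⟩
    · rw [← ha0e, ← hb0e, ← hc0e]; exact key_dd a0 b0 c0
  -- now case on the component of `gens`
  simp only [gens, Finset.mem_union] at hT'
  rcases hT' with (((h | h) | h) | ((h | h) | h)) | ((h | h) | h)
  · obtain ⟨T, hT, hsub⟩ := hdiffs P T' h
    exact ⟨T, by simp only [gens, Finset.mem_union]; exact Or.inl (Or.inl (Or.inl (Or.inl hT))), hsub⟩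
  · obtain ⟨T, hT, hsub⟩ := hdiffs Q T' h
    exact ⟨T, by simp only [gens, Finset.mem_union]; exact Or.inl (Or.inl (Or.inl (Or.inr hT))), hsub⟩
  · obtain ⟨T, hT, hsub⟩ := hdiffs R T' h
    exact ⟨T, by simp only [gens, Finset.mem_union]; exact Or.inl (Or.inl (Or.inr hT)), hsub⟩
  · obtain ⟨T, hT, hsub⟩ := hinfs P Q T' h
    exact ⟨T, by simp only [gens, Finset.mem_union]; exact Or.inl (Or.inr (Or.inl (Or.inl hT))), hsub⟩
  · obtain ⟨T, hT, hsub⟩ := hinfs Q R T' h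
    exact ⟨T, by simp only [gens, Finset.mem_union]; exact Or.inl (Or.inr (Or.inl (Or.inr hT))), hsub⟩
  · obtain ⟨T, hT, hsub⟩ := hinfs R P T' h
    exact ⟨T, by simp only [gens, Finset.mem_union]; exact Or.inl (Or.inr (Or.inr hT)), hsub⟩
  · obtain ⟨T, hT, hsub⟩ := hdd P Q R T' h
    exact ⟨T, by simp only [gens, Finset.mem_union]; exact Or.inr (Or.inl (Or.inl hT)), hsub⟩
  · obtain ⟨T, hT, hsub⟩ := hdd Q R P T' h
    exact ⟨T, by simp only [gens, Finset.mem_union]; exact Or.inr (Or.inl (Or.inr hT)), hsub⟩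
  · obtain ⟨T, hT, hsub⟩ := hdd R P Q T' h
    exact ⟨T, by simp only [gens, Finset.mem_union]; exact Or.inr (Or.inr hT), hsub⟩

/-- Hence the counted family of the pushed families (over `S`) lies inside the counted family of the original
families (over `insert w S`). -/
theorem downFamily_image_erase_subset {S : Finset α} {w : α} (P Q R : Finset (Finset α)) :
    downFamily S (P.image fun U => U.erase w) (Q.image fun U => U.erase w) (R.image fun U => U.erase w) ⊆
      downFamily (insert w S) P Q R := by
  intro F hF
  rw [mem_downFamily] at hF ⊢
  obtain ⟨hFS, T', hT', hFT'⟩ := hF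
  obtain ⟨T, hT, hT'T⟩ := exists_mem_gens_of_mem_gens_image w P Q R hT'
  exact ⟨hFS.trans (Finset.subset_insert w S), T, hT, hFT'.trans hT'T⟩

/-- Double differences are generators (all three cyclic forms). -/
theorem dd_mem_gens_of_mem {P Q R : Finset (Finset α)} {X Y Z : Finset α}
    (h : (X ∈ P ∧ Y ∈ Q ∧ Z ∈ R) ∨ (X ∈ Q ∧ Y ∈ R ∧ Z ∈ P) ∨ (X ∈ R ∧ Y ∈ P ∧ Z ∈ Q)) :
    X \ (Y ∪ Z) ∈ gens P Q R := by
  simp only [gens, Finset.mem_union]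
  right
  rcases h with ⟨h1, h2, h3⟩ | ⟨h1, h2, h3⟩ | ⟨h1, h2, h3⟩
  · left; left
    exact Finset.mem_image.mpr ⟨(X, (Y, Z)), Finset.mem_product.mpr ⟨h1, Finset.mem_product.mpr ⟨h2, h3⟩⟩, rfl⟩
  · left; right
    exact Finset.mem_image.mpr ⟨(X, (Y, Z)), Finset.mem_product.mpr ⟨h1, Finset.mem_product.mpr ⟨h2, h3⟩⟩, rfl⟩
  · right
    exact Finset.mem_image.mpr ⟨(X, (Y, Z)), Finset.mem_product.mpr ⟨h1, Finset.mem_product.mpr ⟨h2, h3⟩⟩, rfl⟩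

/-- The moment of `κ` at the whole ground set is `κ S`. -/
theorem mom_self (S : Finset α) (κ : Finset α → ℚ) : mom S κ S = κ S := by
  unfold mom
  rw [Finset.sum_eq_single S]
  · simp
  · intro U hU hUS
    have hU' : U ⊆ S := Finset.mem_powerset.mp hU
    rw [if_neg]
    intro hSU
    exact hUS (Finset.Subset.antisymm hU' hSU)
  · intro h; exact absurd (Finset.mem_powerset.mpr subset_rfl) h

/-- A function which alternates under insertion of every point of `S` is `(-1)^{#U} d ∅` on subsets of `S`. -/
theorem eq_sign_mul_of_alternating (S : Finset α) (d : Finset α → ℚ)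
    (h : ∀ w ∈ S, ∀ T : Finset α, w ∉ T → T ⊆ S → d T + d (insert w T) = 0) :
    ∀ U : Finset α, U ⊆ S → d U = (-1 : ℚ) ^ #U * d ∅ := by
  intro U
  induction U using Finset.induction_on with
  | empty => intro; simp
  | insert x U hx ih =>
    intro hU
    have hxS : x ∈ S := hU (Finset.mem_insert_self x U)
    have hUS : U ⊆ S := (Finset.subset_insert x U).trans hU
    have h1 := h x hxS U hx hUS
    rw [Finset.card_insert_of_notMem hx, pow_succ]
    have : d (insert x U) = -d U := by linarith
    rw [this, ih hUS]; ring

/-- **TRIPLE-0 (strong form).**  If three functions supported on three families of subsets of `S` have the same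
moments on the counted family `G(S; P, Q, R)`, they are equal. -/
theorem triple0 (S : Finset α) :
    ∀ (P Q R : Finset (Finset α)) (κP κQ κR : Finset α → ℚ),
    (∀ U ∈ P, U ⊆ S) → (∀ U ∈ Q, U ⊆ S) → (∀ U ∈ R, U ⊆ S) →
    (∀ U, U ∉ P → κP U = 0) → (∀ U, U ∉ Q → κQ U = 0) → (∀ U, U ∉ R → κR U = 0) →
    (∀ E ∈ downFamily S P Q R, mom S κP E = mom S κQ E ∧ mom S κQ E = mom S κR E) →
    κP = κQ ∧ κQ = κR := by
  induction S using Finset.strongInduction with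
  | H S ih =>
  intro P Q R κP κQ κR hPS hQS hRS sP sQ sR hmom
  -- Step 1: the pushed instances along every point `w ∈ S`
  have hpush : ∀ w ∈ S, push w κP = push w κQ ∧ push w κQ = push w κR := by
    intro w hw
    have hwS : w ∉ S.erase w := Finset.notMem_erase w S
    have hins : insert w (S.erase w) = S := Finset.insert_erase hw
    refine ih (S.erase w) (Finset.erase_ssubset hw) (P.image fun U => U.erase w)
      (Q.image fun U => U.erase w) (R.image fun U => U.erase w) (push w κP) (push w κQ) (push w κR)
      ?_ ?_ ?_ (fun U hU => push_eq_zero_of_not_mem sP hU) (fun U hU => push_eq_zero_of_not_mem sQ hU)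
      (fun U hU => push_eq_zero_of_not_mem sR hU) ?_
    · intro U hU
      obtain ⟨U0, hU0, rfl⟩ := Finset.mem_image.mp hU
      exact Finset.erase_subset_erase w (hPS U0 hU0)
    · intro U hU
      obtain ⟨U0, hU0, rfl⟩ := Finset.mem_image.mp hU
      exact Finset.erase_subset_erase w (hQS U0 hU0)
    · intro U hU
      obtain ⟨U0, hU0, rfl⟩ := Finset.mem_image.mp hU
      exact Finset.erase_subset_erase w (hRS U0 hU0)
    · intro E hE
      have hE' : E ∈ downFamily S P Q R := by
        have h := downFamily_image_erase_subset (S := S.erase w) (w := w) P Q R hE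
        rwa [hins] at h
      have hwE : w ∉ E := fun h => hwS ((mem_downFamily.mp hE).1 h)
      rw [mom_push (S.erase w) hwS κP hwE, mom_push (S.erase w) hwS κQ hwE,
        mom_push (S.erase w) hwS κR hwE, hins]
      exact hmom E hE'
  -- Step 2: the differences alternate
  set d₁ : Finset α → ℚ := fun U => κP U - κQ U with hd₁
  set d₂ : Finset α → ℚ := fun U => κQ U - κR U with hd₂
  have alt₁ : ∀ U : Finset α, U ⊆ S → d₁ U = (-1 : ℚ) ^ #U * d₁ ∅ := by
    apply eq_sign_mul_of_alternating
    intro w hw T hwT _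
    have h := congrFun (hpush w hw).1 T
    simp only [push, hwT, if_false] at h
    simp only [hd₁]; linarith
  have alt₂ : ∀ U : Finset α, U ⊆ S → d₂ U = (-1 : ℚ) ^ #U * d₂ ∅ := by
    apply eq_sign_mul_of_alternating
    intro w hw T hwT _
    have h := congrFun (hpush w hw).2 T
    simp only [push, hwT, if_false] at h
    simp only [hd₂]; linarith
  have hsign : ∀ U : Finset α, ((-1 : ℚ) ^ #U) ≠ 0 := fun U => pow_ne_zero _ (by norm_num)
  -- Step 3: covering consequences of non-zero constants
  have cover₁ : d₁ ∅ ≠ 0 → ∀ U, U ⊆ S → U ∈ P ∨ U ∈ Q := by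
    intro ha U hU
    by_contra hc
    rw [not_or] at hc
    have h0 : d₁ U = 0 := by simp only [hd₁, sP U hc.1, sQ U hc.2, sub_zero]
    rw [alt₁ U hU] at h0
    exact ha ((mul_eq_zero.mp h0).resolve_left (hsign U))
  have cover₂ : d₂ ∅ ≠ 0 → ∀ U, U ⊆ S → U ∈ Q ∨ U ∈ R := by
    intro ha U hU
    by_contra hc
    rw [not_or] at hc
    have h0 : d₂ U = 0 := by simp only [hd₂, sQ U hc.1, sR U hc.2, sub_zero]
    rw [alt₂ U hU] at h0
    exact ha ((mul_eq_zero.mp h0).resolve_left (hsign U))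
  have cover₃ : d₁ ∅ + d₂ ∅ ≠ 0 → ∀ U, U ⊆ S → U ∈ P ∨ U ∈ R := by
    intro ha U hU
    by_contra hc
    rw [not_or] at hc
    have h0 : d₁ U + d₂ U = 0 := by simp only [hd₁, hd₂, sP U hc.1, sR U hc.2]; ring
    rw [alt₁ U hU, alt₂ U hU, ← mul_add] at h0
    exact ha ((mul_eq_zero.mp h0).resolve_left (hsign U))
  -- Step 4: the equation at `E = S`
  have hSG : S ∈ downFamily S P Q R → d₁ ∅ = 0 ∧ d₂ ∅ = 0 := by
    intro hG
    obtain ⟨h1, h2⟩ := hmom S hG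
    rw [mom_self, mom_self] at h1
    rw [mom_self, mom_self] at h2
    have e1 : d₁ S = 0 := by simp only [hd₁, h1, sub_self]
    have e2 : d₂ S = 0 := by simp only [hd₂, h2, sub_self]
    rw [alt₁ S subset_rfl] at e1
    rw [alt₂ S subset_rfl] at e2
    exact ⟨(mul_eq_zero.mp e1).resolve_left (hsign S), (mul_eq_zero.mp e2).resolve_left (hsign S)⟩
  -- membership of `S` in the counted family, three ways
  have g1 : ∀ T : Finset (Finset α), (T = P ∨ T = Q ∨ T = R) → S ∈ T → ∅ ∈ T →
      S ∈ downFamily S P Q R := by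
    intro T hT hS h0
    rw [mem_downFamily]
    refine ⟨subset_rfl, S \ ∅, ?_, by simp⟩
    apply sdiff_mem_gens_of_mem
    rcases hT with rfl | rfl | rfl
    · exact Or.inl ⟨hS, h0⟩
    · exact Or.inr (Or.inl ⟨hS, h0⟩)
    · exact Or.inr (Or.inr ⟨hS, h0⟩)
  have g2 : (S ∈ P ∧ S ∈ Q) ∨ (S ∈ Q ∧ S ∈ R) ∨ (S ∈ R ∧ S ∈ P) → S ∈ downFamily S P Q R := by
    intro h
    rw [mem_downFamily]
    exact ⟨subset_rfl, S ∩ S, inter_mem_gens_of_mem h, by simp⟩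
  have g3 : (S ∈ P ∧ ∅ ∈ Q ∧ ∅ ∈ R) ∨ (S ∈ Q ∧ ∅ ∈ R ∧ ∅ ∈ P) ∨ (S ∈ R ∧ ∅ ∈ P ∧ ∅ ∈ Q) →
      S ∈ downFamily S P Q R := by
    intro h
    rw [mem_downFamily]
    exact ⟨subset_rfl, S \ (∅ ∪ ∅), dd_mem_gens_of_mem h, by simp⟩
  -- Step 5: the constants vanish
  have main : d₁ ∅ = 0 ∧ d₂ ∅ = 0 := by
    by_cases hG : S ∈ downFamily S P Q R
    · exact hSG hG
    · by_contra hne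
      apply hG
      have eS : (∅ : Finset α) ⊆ S := Finset.empty_subset S
      by_cases h1 : d₁ ∅ = 0
      · -- then d₂ ∅ ≠ 0 and d₁ ∅ + d₂ ∅ ≠ 0 : shared family R
        have h2 : d₂ ∅ ≠ 0 := fun h2 => hne ⟨h1, h2⟩
        have h3 : d₁ ∅ + d₂ ∅ ≠ 0 := by rwa [h1, zero_add]
        rcases cover₂ h2 S subset_rfl with hSQ | hSR
        · rcases cover₃ h3 S subset_rfl with hSP | hSR
          · exact g2 (Or.inl ⟨hSP, hSQ⟩)
          · exact g2 (Or.inr (Or.inl ⟨hSQ, hSR⟩))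
        · rcases cover₂ h2 ∅ eS with h0Q | h0R
          · rcases cover₃ h3 ∅ eS with h0P | h0R
            · exact g3 (Or.inr (Or.inr ⟨hSR, h0P, h0Q⟩))
            · exact g1 R (Or.inr (Or.inr rfl)) hSR h0R
          · exact g1 R (Or.inr (Or.inr rfl)) hSR h0R
      · by_cases h2 : d₂ ∅ = 0
        · -- d₁ ∅ ≠ 0, d₂ ∅ = 0, so d₁ ∅ + d₂ ∅ ≠ 0 : shared family P
          have h3 : d₁ ∅ + d₂ ∅ ≠ 0 := by rwa [h2, add_zero]
          rcases cover₁ h1 S subset_rfl with hSP | hSQ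
          · rcases cover₁ h1 ∅ eS with h0P | h0Q
            · exact g1 P (Or.inl rfl) hSP h0P
            · rcases cover₃ h3 ∅ eS with h0P | h0R
              · exact g1 P (Or.inl rfl) hSP h0P
              · exact g3 (Or.inl ⟨hSP, h0Q, h0R⟩)
          · rcases cover₃ h3 S subset_rfl with hSP | hSR
            · rcases cover₁ h1 ∅ eS with h0P | h0Q
              · exact g1 P (Or.inl rfl) hSP h0P
              · rcases cover₃ h3 ∅ eS with h0P | h0R
                · exact g1 P (Or.inl rfl) hSP h0P
                · exact g3 (Or.inl ⟨hSP, h0Q, h0R⟩)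
            · exact g2 (Or.inr (Or.inl ⟨hSQ, hSR⟩))
        · -- both non-zero : shared family Q
          rcases cover₁ h1 S subset_rfl with hSP | hSQ
          · rcases cover₂ h2 S subset_rfl with hSQ | hSR
            · exact g2 (Or.inl ⟨hSP, hSQ⟩)
            · exact g2 (Or.inr (Or.inr ⟨hSR, hSP⟩))
          · rcases cover₁ h1 ∅ eS with h0P | h0Q
            · rcases cover₂ h2 ∅ eS with h0Q | h0R
              · exact g1 Q (Or.inr (Or.inl rfl)) hSQ h0Q
              · exact g3 (Or.inr (Or.inl ⟨hSQ, h0R, h0P⟩))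
            · exact g1 Q (Or.inr (Or.inl rfl)) hSQ h0Q
  -- Step 6: conclude
  obtain ⟨ha₁, ha₂⟩ := main
  have hPQ : κP = κQ := by
    funext U
    by_cases hU : U ⊆ S
    · have h := alt₁ U hU
      rw [ha₁, mul_zero] at h
      simpa only [hd₁, sub_eq_zero] using h
    · have hUP : U ∉ P := fun h => hU (hPS U h)
      have hUQ : U ∉ Q := fun h => hU (hQS U h)
      rw [sP U hUP, sQ U hUQ]
  have hQR : κQ = κR := by
    funext U
    by_cases hU : U ⊆ S
    · have h := alt₂ U hU
      rw [ha₂, mul_zero] at h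
      simpa only [hd₂, sub_eq_zero] using h
    · have hUQ : U ∉ Q := fun h => hU (hQS U h)
      have hUR : U ∉ R := fun h => hU (hRS U h)
      rw [sQ U hUQ, sR U hUR]
  exact ⟨hPQ, hQR⟩

end ThreeFamilyRank

end Summit.CriticalPhenomena.PercolationContinuityZ3.Theorems
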